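import Summits.HodgeConjecture.HodgeConjecture.Theses.AnchorTransport

/-!
# Sketch for crux idea `rigid-span-anchors` (crux stmt-HodgeConjecture-1077 `AnchorExistence`, round 2, ideator 5)

Typed over the tree's real carriers, no new vocabulary:

* `HRigid n p X c` — the pair `(X, c)` is **H-rigid**: every Hodge datum through `(X, c)` (smooth
  projective family over a smooth irreducible base, global class fibrewise rational `(p,p)` restricting
  to `c` at `s₁` through `e : X ≅ 𝒳_{s₁}`) is COMPATIBLY ISOTRIVIAL at every fibre: there is an iso
  `g : X ≅ 𝒳_{s₀}` with `g^*(A|_{𝒳_{s₀}}) = c`.  (Lead c4, `Lines/Sketch-dead-c4.md` §1(b): infinitesimally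
  rigid pairs on non-uniruled `X` with `H⁰(T_X) = 0` are H-rigid; Movasati's "general Hodge cycles".)
* `RigidCore` — HC on H-rigid pairs (the crux's HC-verbatim core: by tightness it is IMPLIED by
  `AnchorExistence`, theorem `rigidCore_of_anchorExistence` below).
* `RigidAnchors` — every Hodge class reaches, inside one Hodge datum, a fibre where it lies in the
  `ℂ`-span of rational `(p,p)` classes that are H-rigid OR algebraic ("rigid-or-known anchor").
* LOSSLESS SPLIT, proved: `AnchorExistence ↔ RigidCore ∧ RigidAnchors`.
* `PencilInjective` / `SpanningLemma` — the linear-algebra heart of the lever (statements; Mathlib only):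
  injectivity along a pencil fails at finitely many parameters, hence ONE rigid class makes the rigid
  classes span.
-/

noncomputable section

set_option linter.dupNamespace false

open CategoryTheory AlgebraicGeometry
open Literature.AlgebraicGeometry Literature.AlgebraicGeometry.Motives
  Literature.AlgebraicGeometry.HodgeTheory
open Summit.HodgeConjecture.HodgeConjecture.Theses.AnchorTransport

namespace Summit.HodgeConjecture.HodgeConjecture.Cruxes.AnchorExistence.RigidSpanAnchors

/-- **H-rigidity of a pair `(X, c)`** (`X` of dimension `n`, `c ∈ H²ᵖ(X(ℂ); ℂ)`): every Hodge datum
through `(X, c)` is compatibly isotrivial at every fibre. -/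
def HRigid (n p : ℕ) (X : SchemeOver ℂ) (c : complexBetti X (2 * p)) : Prop :=
  ∀ (𝒳 S : SchemeOver ℂ) (f : 𝒳 ⟶ S) (s₁ : ComplexPoints S) (e : X ≅ fiberOver f s₁)
    (A : complexBetti 𝒳 (2 * p)),
    IsSmoothProjectiveFamily f n → IrreducibleSpace S.left → AlgebraicGeometry.Smooth S.hom →
    (∀ s : ComplexPoints S, IsRationalClass (complexBetti.map (fiberι f s) (2 * p) A) ∧
      IsOfHodgeType n (fiberOver f s) (2 * p) p p (complexBetti.map (fiberι f s) (2 * p) A)) →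
    complexBetti.map e.hom (2 * p) (complexBetti.map (fiberι f s₁) (2 * p) A) = c →
    ∀ s₀ : ComplexPoints S, ∃ g : X ≅ fiberOver f s₀,
      complexBetti.map g.hom (2 * p) (complexBetti.map (fiberι f s₀) (2 * p) A) = c

/-- **The rigid core**: the Hodge conjecture for H-rigid pairs. -/
def RigidCore : Prop :=
  ∀ ⦃n : ℕ⦄ ⦃X : SchemeOver ℂ⦄, IsSmoothProjective n X →
    ∀ (p : ℕ) (c : complexBetti X (2 * p)), IsRationalClass c → IsOfHodgeType n X (2 * p) p p c →
      HRigid n p X c → c ∈ algebraicClasses X p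

/-- The generating set at an anchor fibre `Y`: rational `(p,p)` classes that are H-rigid or algebraic. -/
def rigidOrAlgebraic (n p : ℕ) (Y : SchemeOver ℂ) : Set (complexBetti Y (2 * p)) :=
  {x | IsRationalClass x ∧ IsOfHodgeType n Y (2 * p) p p x ∧ (HRigid n p Y x ∨ x ∈ algebraicClasses Y p)}

/-- **Rigid-or-known anchors**: every rational `(p,p)` class is, inside one Hodge datum, a fibre
restriction of a global class whose restriction to SOME fibre lies in the `ℂ`-span of rational `(p,p)`
classes that are H-rigid or algebraic. -/
def RigidAnchors : Prop :=
  ∀ ⦃n : ℕ⦄ ⦃X : SchemeOver ℂ⦄, IsSmoothProjective n X →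
    ∀ (p : ℕ) (c : complexBetti X (2 * p)), IsRationalClass c → IsOfHodgeType n X (2 * p) p p c →
      ∃ (𝒳 S : SchemeOver ℂ) (f : 𝒳 ⟶ S) (s₁ s₀ : ComplexPoints S) (e : X ≅ fiberOver f s₁)
        (A : complexBetti 𝒳 (2 * p)),
        IsSmoothProjectiveFamily f n ∧ IrreducibleSpace S.left ∧ AlgebraicGeometry.Smooth S.hom ∧
        (∀ s : ComplexPoints S, IsRationalClass (complexBetti.map (fiberι f s) (2 * p) A) ∧
          IsOfHodgeType n (fiberOver f s) (2 * p) p p (complexBetti.map (fiberι f s) (2 * p) A)) ∧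
        complexBetti.map e.hom (2 * p) (complexBetti.map (fiberι f s₁) (2 * p) A) = c ∧
        complexBetti.map (fiberι f s₀) (2 * p) A ∈
          Submodule.span ℂ (rigidOrAlgebraic n p (fiberOver f s₀))

/-- **Tightness, ∀-form**: `AnchorExistence` implies the Hodge conjecture on H-rigid pairs
(anchor datum + compatible iso at the anchor fibre + `IsoInvariance`). -/
theorem rigidCore_of_anchorExistence (hAn : AnchorExistence) : RigidCore := by
  intro n X hX p c hc hpp hrig
  obtain ⟨𝒳, S, f, s₁, s₀, e, A, hf, hirr, hsm, hfib, hAc, hs₀⟩ := hAn hX p c hc hpp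
  obtain ⟨g, hg⟩ := hrig 𝒳 S f s₁ e A hf hirr hsm hfib hAc s₀
  rw [← hg]
  exact IsoInvariance_holds g p _ hs₀

/-- `AnchorExistence` implies `RigidAnchors` (an algebraic anchor is a rigid-or-known anchor). -/
theorem rigidAnchors_of_anchorExistence (hAn : AnchorExistence) : RigidAnchors := by
  intro n X hX p c hc hpp
  obtain ⟨𝒳, S, f, s₁, s₀, e, A, hf, hirr, hsm, hfib, hAc, hs₀⟩ := hAn hX p c hc hpp
  exact ⟨𝒳, S, f, s₁, s₀, e, A, hf, hirr, hsm, hfib, hAc,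
    Submodule.subset_span ⟨(hfib s₀).1, (hfib s₀).2, Or.inr hs₀⟩⟩

/-- **The lever as a reduction**: HC on the rigid core plus rigid-or-known anchors give
`AnchorExistence` — at the anchor fibre every generator is algebraic (rigid ones by `RigidCore`), and
`algebraicClasses` is a `ℂ`-submodule. -/
theorem anchorExistence_of_rigidCore_of_rigidAnchors (hCore : RigidCore) (hAnch : RigidAnchors) :
    AnchorExistence := by
  intro n X hX p c hc hpp
  obtain ⟨𝒳, S, f, s₁, s₀, e, A, hf, hirr, hsm, hfib, hAc, hspan⟩ := hAnch hX p c hc hpp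
  refine ⟨𝒳, S, f, s₁, s₀, e, A, hf, hirr, hsm, hfib, hAc, ?_⟩
  refine (Submodule.span_le.mpr ?_) hspan
  rintro x ⟨hxr, hxpp, hx | hx⟩
  · exact hCore (hf.isSmoothProjective s₀) p x hxr hxpp hx
  · exact hx

/-- **Lossless split of the crux along the rigid/anchored fault line.** -/
theorem anchorExistence_iff_rigidCore_and_rigidAnchors :
    AnchorExistence ↔ RigidCore ∧ RigidAnchors :=
  ⟨fun h ↦ ⟨rigidCore_of_anchorExistence h, rigidAnchors_of_anchorExistence h⟩,
    fun h ↦ anchorExistence_of_rigidCore_of_rigidAnchors h.1 h.2⟩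

/-! ### The linear-algebra heart (first lemma of the line), Mathlib only -/

/-- **Pencil lemma** (statement): if `φ₀ : W₁ → W₂` is injective and `W₁` is finite-dimensional,
then `φ₀ + t • φ₁` is injective for all but finitely many `t`. -/
def PencilInjective : Prop :=
  ∀ (K : Type) [Field K] (W₁ W₂ : Type) [AddCommGroup W₁] [Module K W₁] [FiniteDimensional K W₁]
    [AddCommGroup W₂] [Module K W₂] (φ₀ φ₁ : W₁ →ₗ[K] W₂),
    Function.Injective φ₀ → Set.Finite {t : K | ¬ Function.Injective (φ₀ + t • φ₁)}

/-- **Spanning lemma** (statement): for a linear family `∇ : V → Hom(W₁, W₂)` over an infinite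
field, if ONE `v₀` has `∇ v₀` injective then the `v` with `∇ v` injective span `V`.
(Applied with `V = Hdg²ᵖ(Y) ⊗ K`, `W₁ = H¹(T_Y)`, `W₂ = H^{p-1,p+1}(Y)`, `∇ v = (θ ↦ θ ⌟ v)`: one
infinitesimally rigid Hodge class makes the rigid Hodge classes span.) -/
def SpanningLemma : Prop :=
  ∀ (K : Type) [Field K] [Infinite K] (V W₁ W₂ : Type) [AddCommGroup V] [Module K V]
    [AddCommGroup W₁] [Module K W₁] [FiniteDimensional K W₁] [AddCommGroup W₂] [Module K W₂]
    (D : V →ₗ[K] (W₁ →ₗ[K] W₂)) (v₀ : V), Function.Injective (D v₀) →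
    Submodule.span K {v : V | Function.Injective (D v)} = ⊤

/-- The spanning lemma follows from the pencil lemma (choose `t ∉` the finite bad set, `t ≠ 0`). -/
theorem spanningLemma_of_pencilInjective (h : PencilInjective) : SpanningLemma := by
  intro K _ _ V W₁ W₂ _ _ _ _ _ _ _ D v₀ hv₀
  rw [Submodule.eq_top_iff']
  intro w
  have hfin := h K W₁ W₂ (D v₀) (D w) hv₀
  -- the bad parameters together with `0` form a finite set; an infinite field has a point outside
  obtain ⟨t, ht⟩ := (hfin.union (Set.finite_singleton (0 : K))).infinite_compl.nonempty
  simp only [Set.mem_compl_iff, Set.mem_union, Set.mem_setOf_eq, Set.mem_singleton_iff,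
    not_or, not_not] at ht
  obtain ⟨hinj, ht0⟩ := ht
  have hmem : v₀ + t • w ∈ Submodule.span K {v : V | Function.Injective (D v)} := by
    refine Submodule.subset_span ?_
    simpa [map_add, map_smul] using hinj
  have hv₀mem : v₀ ∈ Submodule.span K {v : V | Function.Injective (D v)} :=
    Submodule.subset_span hv₀
  have : t • w ∈ Submodule.span K {v : V | Function.Injective (D v)} := by
    simpa using Submodule.sub_mem _ hmem hv₀mem
  simpa [smul_smul, inv_mul_cancel₀ ht0] using Submodule.smul_mem _ t⁻¹ this

/-- **The pencil lemma holds** (proof: a left inverse `ψ` of `φ₀` turns a kernel vector of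
`φ₀ + t • φ₁` into an eigenvector of `ψ ∘ φ₁` with eigenvalue `-t⁻¹`; eigenvalues are finite). -/
theorem pencilInjective : PencilInjective := by
  intro K _ W₁ W₂ _ _ _ _ _ φ₀ φ₁ h₀
  obtain ⟨ψ, hψ⟩ := LinearMap.exists_leftInverse_of_injective φ₀ (LinearMap.ker_eq_bot.mpr h₀)
  set g : Module.End K W₁ := ψ.comp φ₁ with hg
  have hfin : Set.Finite {μ : K | g.HasEigenvalue μ} := g.finite_hasEigenvalue
  refine (hfin.image (fun μ ↦ -μ⁻¹)).subset ?_
  intro t ht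
  simp only [Set.mem_setOf_eq] at ht
  rw [← LinearMap.ker_eq_bot, Submodule.eq_bot_iff] at ht
  push Not at ht
  obtain ⟨x, hx, hx0⟩ := ht
  have hx' : φ₀ x + t • φ₁ x = 0 := by
    simpa [LinearMap.mem_ker] using hx
  have hψx : x + t • g x = 0 := by
    have h1 := congrArg ψ hx'
    have h2 : ψ (φ₀ x) = x := by
      rw [← LinearMap.comp_apply, hψ, LinearMap.id_apply]
    simpa [map_add, map_smul, hg, h2] using h1
  have ht0 : t ≠ 0 := by
    rintro rfl
    simp only [zero_smul, add_zero] at hψx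
    exact hx0 hψx
  refine ⟨-t⁻¹, ?_, by simp [inv_neg, inv_inv]⟩
  refine Module.End.hasEigenvalue_of_hasEigenvector ⟨?_, hx0⟩
  rw [Module.End.mem_eigenspace_iff]
  have h3 : t • g x = -x := eq_neg_of_add_eq_zero_right hψx
  calc g x = t⁻¹ • (t • g x) := by rw [smul_smul, inv_mul_cancel₀ ht0, one_smul]
    _ = (-t⁻¹) • x := by rw [h3, smul_neg, neg_smul]

/-- Hence the spanning lemma holds unconditionally. -/
theorem spanningLemma : SpanningLemma := spanningLemma_of_pencilInjective pencilInjective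

end Summit.HodgeConjecture.HodgeConjecture.Cruxes.AnchorExistence.RigidSpanAnchors

end
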